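import Literature.Probability.RandomPlanarGeometry.LoewnerMoebiusClock
import Literature.Probability.RandomPlanarGeometry.SLERealFlowIto
import HarnessLib

/-!
# The Möbius image of a chordal Loewner chain is a Loewner chain in capacity time (maps and hulls)

Topic `Probability/RandomPlanarGeometry`. Deterministic half of the locality theorem for chordal
SLE under a Möbius map (G. F. Lawler, *Conformally Invariant Processes in the Plane* (2005),
§4.6.1 and §6.3, Thm. 6.13 / Prop. 6.14; tree: `sle_six_moebius_locality`): for the chordal
Loewner chain `(g_u, K_u)` of a continuous driving function `W` and the Möbius map
`N(z) = a + b/(p - z)` of `ℍ` (`b > 0`, real pole `p ≠ W_0`), and any horizon `u₁ < T_p`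
(the pole not yet swallowed), the image hulls `N(K_u)`, `u ≤ u₁`, re-parametrised by the capacity
clock `clock u = ∫₀ᵘ h_s'(W_s)² ds`, ARE the hulls of the chordal Loewner chain driven by the
time-changed image driver `U = timeChangedDriver` (`= h_u(W_u)` at `clock u`;
`LoewnerMoebiusClock.lean`), and the image maps are `g^U_{clock u} ∘ N = h_u ∘ g_u`.

The pole data are those of `LoewnerMoebiusClock` for the **clamped gap path**
`gap W p u₁ u = X_{(u ∧ u₁)⁺}`, `X = Loewner.realFlowStop W p` the real flow of the pole seen
from the driving function (continuous and nowhere zero since `u₁ < T_p`); on `[0, u₁]` the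
quadrature `poleFlow` is the genuine pole flow, `poleFlow u - gap u = W_u`
(`poleFlow_gap_sub_gap`, the real Loewner equation integrated, `realFlowStop_eq_sub_add_integral`).

* `IsSolution.exists_hasDerivAt_extension` — a Loewner solution, modified before time `0`, has an
  honest two-sided derivative at every time of `[0, T)` (bookkeeping for the chain rule at `0`);
* `isSolution_imageSol` — **the conjugated solution `t ↦ h_{υt}(g_{υt}(z))` solves Loewner's
  equation driven by `U`** from `N(z)` with lifetime `clock u'` (`hasDerivAt_conjMap_invClock`);
* `map_imageDriver_apply`, `domain_imageDriver_eq`, `hull_imageDriver_eq` — for `u < u₁`: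
  `N(H_u) = H^U_{clock u}`, `g^U_{clock u}(N z) = h_u(g_u z)` on `H_u`, and
  **`K^U_{clock u} = N(K_u)`** (both maps are bijections onto `ℍ`, `Loewner.bijOn_map`,
  intertwined by the Möbius automorphism `h_u` of `ℍ`, whose inverse is `conjMapInv`);
* `isSolution_farPoint`, `map_imageDriver_far`, `realFlowStop_imageDriver_far` — the tracked
  real point `a = N(∞)` is alive under `U` up to `clock u₁`, with `g^U_{clock u}(a) = farPoint u`
  and gap `X̂_{clock u} = -b d₁(u)/X_u` (`hasDerivAt_farPoint_invClock`).

What is NOT here: the generating curve of the image chain (`LoewnerMoebiusImageTrace`) and any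
probability.

## References

* G. F. Lawler, *Conformally Invariant Processes in the Plane*, AMS (2005), §4.6.1, §6.3
  (Thm. 6.13, Prop. 6.14). [Lawler2005]
* O. Schramm, D. B. Wilson, *SLE coordinate changes*, New York J. Math. 11 (2005), §4 (the
  template `RadialChordalConjugation`). [SchrammWilson2005]
-/

noncomputable section

open Set Filter Topology MeasureTheory Complex
open UpperHalfPlane (upperHalfPlaneSet)
open scoped NNReal

namespace Literature.Probability.RandomPlanarGeometry

namespace MoebiusPole

open Loewner

/-! ### A Loewner solution with a two-sided derivative at time `0` -/

/-- **Extension of a Loewner solution before time `0`.** A solution `g` of the chordal Loewner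
equation from `z` with positive lifetime `T` agrees on `[0, ∞)` with a function having, at every
time `u ∈ [0, T)`, the honest (two-sided) derivative `2/(g_u - W_u)` — extend linearly before `0`
with slope the field at `z`. (Bookkeeping: it lets the chain rule be applied at `u = 0`.)
[folklore] -/
theorem _root_.Literature.Probability.RandomPlanarGeometry.Loewner.IsSolution.exists_hasDerivAt_extension
    {W : ℝ≥0 → ℝ} {z : ℂ} {g : ℝ → ℂ} {T : WithTop ℝ≥0} (h : IsSolution W z g T) :
    ∃ g' : ℝ → ℂ, (∀ u, 0 ≤ u → g' u = g u) ∧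
      ∀ u, 0 ≤ u → (u.toNNReal : WithTop ℝ≥0) < T → HasDerivAt g' (vectorField W u (g' u)) u := by
  set v : ℂ := vectorField W 0 z with hv
  set g' : ℝ → ℂ := fun u ↦ if 0 ≤ u then g u else z + (u : ℂ) * v with hg'
  have hge : ∀ u, 0 ≤ u → g' u = g u := fun u hu ↦ by simp [hg', hu]
  refine ⟨g', hge, fun u hu huT ↦ ?_⟩
  rcases hu.eq_or_lt with rfl | hu0
  · -- at `u = 0`: right derivative from the equation, left derivative from the linear extension
    have hg0 : g' 0 = z := by rw [hge 0 le_rfl, h.apply_zero]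
    rw [hg0]
    have hR : HasDerivWithinAt g' v (Ici 0) 0 := by
      have h1 : HasDerivWithinAt g (vectorField W 0 (g 0))
          {t : ℝ | 0 ≤ t ∧ (t.toNNReal : WithTop ℝ≥0) < T} 0 := h.isIntegralCurveOn 0 ⟨le_rfl, huT⟩
      rw [h.apply_zero] at h1
      have hmem : {t : ℝ | 0 ≤ t ∧ (t.toNNReal : WithTop ℝ≥0) < T} ∈ 𝓝[Ici (0 : ℝ)] (0 : ℝ) :=
        inter_mem self_mem_nhdsWithin (mem_nhdsWithin_of_mem_nhds (setOf_toNNReal_lt_mem_nhds huT))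
      exact (h1.mono_of_mem_nhdsWithin hmem).congr (fun t ht ↦ hge t ht) (by rw [hg0, h.apply_zero])
    have hL : HasDerivWithinAt g' v (Iic 0) 0 := by
      have h1 : HasDerivAt (fun u : ℝ ↦ z + (u : ℂ) * v) (1 * v) 0 :=
        ((hasDerivAt_id (0 : ℝ)).ofReal_comp.mul_const v).const_add z
      rw [one_mul] at h1
      refine h1.hasDerivWithinAt.congr (fun t ht ↦ ?_) (by rw [hg0]; push_cast; ring)
      rcases (mem_Iic.1 ht).eq_or_lt with rfl | htlt
      · rw [hg0]; push_cast; ring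
      · simp [hg', not_le.2 htlt]
    simpa using hL.union hR
  · have h1 := h.hasDerivAt hu0 huT
    have hev : g' =ᶠ[𝓝 u] g := by
      filter_upwards [Ioi_mem_nhds hu0] with t ht using hge t (le_of_lt ht)
    rw [hge u hu]
    exact h1.congr_of_eventuallyEq hev

/-! ### The clamped gap path of the pole -/

section Gap

variable (W : ℝ≥0 → ℝ) (p : ℝ) (u₁ : ℝ≥0)

/-- **The clamped gap path of the pole** `X_u = g_u(p) - W_u` (`Loewner.realFlowStop`, the real
Loewner flow of `p` seen from the driving function), read at the clamped time `(u ∧ u₁)⁺`; for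
`u₁ < T_p` it is continuous and nowhere zero on `ℝ`, and on `[0, u₁]` it is the gap itself.
[cite: Lawler2005, §4.6.1] -/
def gap (u : ℝ) : ℝ :=
  realFlowStop W p (min u u₁).toNNReal

/-- **The Möbius map `N(z) = a + b/(p - z)`** (Lawler's `Φ`; for `a = x`, `b = x²`, `p = -x` it
is the re-targeting map `x z/(z + x)`, `retarget_eq_moebiusConj_init`). [cite: Lawler2005, §6.3] -/
def moebN (a b p : ℝ) (z : ℂ) : ℂ :=
  a + b / ((p : ℂ) - z)

/-- **The image driving function** of the chain driven by `W` under `N`, in capacity time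
(`timeChangedDriver` of the clamped gap). [cite: Lawler2005, §6.3] -/
def imageDriver (a b : ℝ) : ℝ≥0 → ℝ :=
  timeChangedDriver a b (gap W p u₁) u₁

/-- The capacity clock at a nonnegative original time, as an element of `ℝ≥0`. [folklore] -/
def clockNN (b : ℝ) (u : ℝ≥0) : ℝ≥0 :=
  (clock b (gap W p u₁) u).toNNReal

/-- **The conjugated solution** attached to a Loewner solution `g`:
`Z_t = h_{υ t}(g_{υ t})`. [cite: Lawler2005, §6.3] -/
def imageSol (a b : ℝ) (g : ℝ → ℂ) (t : ℝ) : ℂ :=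
  conjMap a b p (gap W p u₁) (invClock b (gap W p u₁) u₁ t) (g (invClock b (gap W p u₁) u₁ t))

/-- **The inverse of the conjugating Möbius map** `h_u⁻¹(w) = P_u - b d₁(u)/(w - A_u)`.
[folklore] -/
def conjMapInv (a b : ℝ) (u : ℝ) (w : ℂ) : ℂ :=
  (poleFlow p (gap W p u₁) u : ℂ) -
    b * poleDeriv (gap W p u₁) u / (w - farPoint a b (gap W p u₁) u)

variable {W p u₁}

/-- On `[0, u₁]` the clamp is inactive. [folklore] -/
theorem gap_of_mem {u : ℝ} (hu : u ∈ Icc (0 : ℝ) u₁) : gap W p u₁ u = realFlowStop W p u.toNNReal := by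
  rw [gap, min_eq_left hu.2]

/-- At an `ℝ≥0` time `u ≤ u₁`, `gap u = X_u`. [folklore] -/
theorem gap_coe {u : ℝ≥0} (hu : u ≤ u₁) : gap W p u₁ u = realFlowStop W p u := by
  rw [gap_of_mem ⟨u.coe_nonneg, NNReal.coe_le_coe.2 hu⟩, Real.toNNReal_coe]

variable (hW : Continuous W) (hp : p ≠ W 0)
include hW hp

/-- The clamped gap path is continuous. [folklore] -/
theorem continuous_gap : Continuous (gap W p u₁) :=
  (continuous_realFlowStop_of_ne hW hp).comp
    (continuous_real_toNNReal.comp (continuous_id.min continuous_const))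

variable (hu₁ : (u₁ : WithTop ℝ≥0) < swallowingTime W p)
include hu₁

omit hW hp in
/-- The clamped time is before the swallowing time of the pole. [folklore] -/
theorem clamp_lt_swallowingTime (u : ℝ) :
    ((min u u₁).toNNReal : WithTop ℝ≥0) < swallowingTime W p :=
  lt_of_le_of_lt (WithTop.coe_le_coe.2 (Real.toNNReal_le_iff_le_coe.2 (min_le_right _ _))) hu₁

/-- **The clamped gap path is nowhere zero** (`u₁ < T_p`). [folklore] -/
theorem gap_ne_zero (u : ℝ) : gap W p u₁ u ≠ 0 := by
  have hlt := clamp_lt_swallowingTime (W := W) (p := p) hu₁ u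
  rw [gap, realFlowStop_of_lt hlt]
  rcases lt_or_gt_of_ne hp with h | h
  · exact (realFlow_neg hW h hlt).ne
  · exact (realFlow_pos hW h hlt).ne'

/-- **The quadrature pole flow is the pole flow**: on `[0, u₁]`,
`poleFlow p (gap) u - gap u = W_u` (the real Loewner equation integrated,
`realFlowStop_eq_sub_add_integral`). [cite: Lawler2005, §4.6.1] -/
theorem poleFlow_gap_sub_gap {u : ℝ} (hu : u ∈ Icc (0 : ℝ) u₁) :
    poleFlow p (gap W p u₁) u - gap W p u₁ u = W u.toNNReal := by
  have hut : ((u.toNNReal : ℝ≥0) : WithTop ℝ≥0) < swallowingTime W p := by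
    have := clamp_lt_swallowingTime (W := W) (p := p) hu₁ u
    rwa [min_eq_left hu.2] at this
  have h := realFlowStop_eq_sub_add_integral hW hp hut
  rw [Real.coe_toNNReal _ hu.1] at h
  have hint : ∫ s in (0 : ℝ)..u, 2 / gap W p u₁ s = ∫ s in (0 : ℝ)..u, 2 / realFlowStop W p s.toNNReal := by
    refine intervalIntegral.integral_congr fun s hs ↦ ?_
    rw [uIcc_of_le hu.1] at hs
    simp only [gap_of_mem ⟨hs.1, hs.2.trans hu.2⟩]
  rw [poleFlow, gap_of_mem hu, hint, h]
  ring

end Gap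

/-! ### The conjugating map and its inverse -/

section ConjMap

variable {W : ℝ≥0 → ℝ} {p : ℝ} {u₁ : ℝ≥0} {a b : ℝ}

/-- `Im (r/w) = -r Im w/|w|²` for real `r`. [folklore] -/
theorem im_ofReal_div (r : ℝ) (w : ℂ) : ((r : ℂ) / w).im = -(r * w.im) / Complex.normSq w := by
  rw [Complex.div_im, ofReal_im, ofReal_re]
  ring

/-- A point of `ℍ` is not a real number. [folklore] -/
theorem ofReal_sub_ne_zero (r : ℝ) {y : ℂ} (hy : 0 < y.im) : (r : ℂ) - y ≠ 0 := fun h ↦ by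
  have := congrArg Complex.im h
  rw [Complex.sub_im, ofReal_im, zero_sub, Complex.zero_im, neg_eq_zero] at this
  exact hy.ne' this

/-- `h_u` maps `ℍ` into `ℍ` (`b > 0`, `d₁ > 0`: `Im h_u(y) = b d₁ Im y/|P - y|²`). [folklore] -/
theorem im_conjMap_pos (hb : 0 < b) (u : ℝ) {y : ℂ} (hy : 0 < y.im) :
    0 < (conjMap a b p (gap W p u₁) u y).im := by
  have hd₁ : 0 < poleDeriv (gap W p u₁) u := poleDeriv_pos u
  have hne : (poleFlow p (gap W p u₁) u : ℂ) - y ≠ 0 := ofReal_sub_ne_zero _ hy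
  have hns : 0 < Complex.normSq ((poleFlow p (gap W p u₁) u : ℂ) - y) := Complex.normSq_pos.2 hne
  have key : conjMap a b p (gap W p u₁) u y =
      ((a - b * poleDeriv₂ (gap W p u₁) u / (2 * poleDeriv (gap W p u₁) u) : ℝ) : ℂ) +
        ((b * poleDeriv (gap W p u₁) u : ℝ) : ℂ) / ((poleFlow p (gap W p u₁) u : ℂ) - y) := by
    rw [conjMap, moebiusConjC_apply]
    push_cast
    ring
  have him : ((poleFlow p (gap W p u₁) u : ℂ) - y).im = -y.im := by simp
  rw [key, Complex.add_im, ofReal_im, im_ofReal_div, him, zero_add]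
  have : -(b * poleDeriv (gap W p u₁) u * -y.im) / Complex.normSq ((poleFlow p (gap W p u₁) u : ℂ) - y) =
      b * poleDeriv (gap W p u₁) u * y.im / Complex.normSq ((poleFlow p (gap W p u₁) u : ℂ) - y) := by
    ring
  rw [this]
  positivity

/-- `h_u⁻¹` is a right inverse of `h_u` off the far value. [folklore] -/
theorem conjMap_conjMapInv (hb : b ≠ 0) (u : ℝ) {w : ℂ} (hw : w ≠ farPoint a b (gap W p u₁) u) :
    conjMap a b p (gap W p u₁) u (conjMapInv W p u₁ a b u w) = w := by
  have hd₁ : (poleDeriv (gap W p u₁) u : ℂ) ≠ 0 := ofReal_ne_zero.2 (poleDeriv_pos u).ne'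
  have hb' : (b : ℂ) ≠ 0 := ofReal_ne_zero.2 hb
  have hwA : w - ((a : ℂ) - (b : ℂ) / 2 * (poleRatio (gap W p u₁) u : ℂ)) ≠ 0 := by
    have h := sub_ne_zero.2 hw
    rw [farPoint] at h
    push_cast at h
    exact h
  rw [conjMap, moebiusConjC_apply, conjMapInv, sub_sub_cancel, poleDeriv₂, farPoint]
  push_cast
  field_simp
  ring

/-- A point of `ℍ` minus a real number is nonzero. [folklore] -/
theorem sub_ofReal_ne_zero (r : ℝ) {w : ℂ} (hw : 0 < w.im) : w - (r : ℂ) ≠ 0 := fun h ↦ by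
  have := congrArg Complex.im h
  rw [Complex.sub_im, ofReal_im, sub_zero, Complex.zero_im] at this
  exact hw.ne' this

/-- `h_u⁻¹` maps `ℍ` into `ℍ` (`b > 0`). [folklore] -/
theorem im_conjMapInv_pos (hb : 0 < b) (u : ℝ) {w : ℂ} (hw : 0 < w.im) :
    0 < (conjMapInv W p u₁ a b u w).im := by
  set A := farPoint a b (gap W p u₁) u
  set d₁ := poleDeriv (gap W p u₁) u
  have hd₁ : 0 < d₁ := poleDeriv_pos u
  have hne : w - (A : ℂ) ≠ 0 := sub_ofReal_ne_zero A hw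
  have hns : 0 < Complex.normSq (w - (A : ℂ)) := Complex.normSq_pos.2 hne
  have key : conjMapInv W p u₁ a b u w =
      ((poleFlow p (gap W p u₁) u : ℝ) : ℂ) - ((b * d₁ : ℝ) : ℂ) / (w - A) := by
    rw [conjMapInv]
    push_cast
    ring
  have him : (w - (A : ℂ)).im = w.im := by simp
  rw [key, Complex.sub_im, ofReal_im, im_ofReal_div, him, zero_sub]
  have : -(-(b * d₁ * w.im) / Complex.normSq (w - (A : ℂ))) =
      b * d₁ * w.im / Complex.normSq (w - (A : ℂ)) := by ring
  rw [this]
  positivity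

/-- `N` maps `ℍ` into `ℍ` (`b > 0`). [folklore] -/
theorem im_moebN_pos (hb : 0 < b) {z : ℂ} (hz : 0 < z.im) : 0 < (moebN a b p z).im := by
  have hne : (p : ℂ) - z ≠ 0 := ofReal_sub_ne_zero p hz
  have hns : 0 < Complex.normSq ((p : ℂ) - z) := Complex.normSq_pos.2 hne
  have him : ((p : ℂ) - z).im = -z.im := by simp
  rw [moebN, Complex.add_im, ofReal_im, im_ofReal_div, him, zero_add]
  have : -(b * -z.im) / Complex.normSq ((p : ℂ) - z) = b * z.im / Complex.normSq ((p : ℂ) - z) := by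
    ring
  rw [this]
  positivity

/-- `h_0 = N`. [folklore] -/
theorem conjMap_zero_eq_moebN (z : ℂ) : conjMap a b p (gap W p u₁) 0 z = moebN a b p z := by
  rw [conjMap_zero, moebN]

end ConjMap

/-! ### The conjugated solutions solve the image Loewner equation -/

section Chordal

variable {W : ℝ≥0 → ℝ} {p : ℝ} {u₁ : ℝ≥0} {a b : ℝ}
variable (hW : Continuous W) (hp : p ≠ W 0) (hu₁ : (u₁ : WithTop ℝ≥0) < swallowingTime W p)
  (hb : 0 < b)
include hW hp hu₁ hb

/-- The image driving function is continuous. [folklore] -/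
theorem continuous_imageDriver : Continuous (imageDriver W p u₁ a b) :=
  continuous_timeChangedDriver (continuous_gap hW hp) (gap_ne_zero hW hp hu₁) hb.ne' u₁.coe_nonneg

/-- For a nonnegative time the clock is nonnegative, so `clockNN` is the clock. [folklore] -/
theorem coe_clockNN (u : ℝ≥0) : (clockNN W p u₁ b u : ℝ) = clock b (gap W p u₁) u := by
  rw [clockNN, Real.coe_toNNReal _
    (clock_nonneg (continuous_gap hW hp) (gap_ne_zero hW hp hu₁) hb.ne' u.coe_nonneg)]

/-- The clock in `ℝ≥0` is strictly increasing. [folklore] -/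
theorem clockNN_lt_clockNN {u u' : ℝ≥0} (h : u < u') : clockNN W p u₁ b u < clockNN W p u₁ b u' := by
  rw [← NNReal.coe_lt_coe, coe_clockNN hW hp hu₁ hb, coe_clockNN hW hp hu₁ hb]
  exact strictMono_clock (continuous_gap hW hp) (gap_ne_zero hW hp hu₁) hb.ne' (NNReal.coe_lt_coe.2 h)

/-- **Undoing the time change on the driver**: `U_{clock u} = h_u(W_u) = driver u` for
`u ≤ u₁`. [folklore] -/
theorem imageDriver_clockNN {u : ℝ≥0} (hu : u ≤ u₁) :
    imageDriver W p u₁ a b (clockNN W p u₁ b u) = driver a b (gap W p u₁) u := by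
  have h := timeChangedDriver_clock (a := a) (continuous_gap hW hp) (gap_ne_zero hW hp hu₁) hb.ne'
    u₁.coe_nonneg (u := u) ⟨u.coe_nonneg, NNReal.coe_le_coe.2 hu⟩
  exact h

/-- `U_0 = N(W_0)`. [folklore] -/
theorem imageDriver_zero : imageDriver W p u₁ a b 0 = a + b / (p - W 0) := by
  rw [imageDriver, timeChangedDriver_zero (continuous_gap hW hp) (gap_ne_zero hW hp hu₁) hb.ne'
    u₁.coe_nonneg, gap, min_eq_left (u₁.coe_nonneg), Real.toNNReal_zero,
    realFlowStop_zero_of_ne hW hp]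

/-- A level in `[0, clock u')`, `u' ≤ u₁`, is reached at an original time in `[0, u')`, and the
level range hypotheses of `LoewnerMoebiusClock` hold there. [folklore] -/
theorem invClock_mem_of_lt {u' : ℝ≥0} (hu' : u' ≤ u₁) {t : ℝ} (ht0 : 0 ≤ t)
    (ht : t < clock b (gap W p u₁) u') :
    invClock b (gap W p u₁) u₁ t ∈ Ico (0 : ℝ) u' ∧
      t ∈ Ioo (clock b (gap W p u₁) (-1)) (clock b (gap W p u₁) (u₁ + 1)) := by
  have hX := continuous_gap (u₁ := u₁) hW hp
  have hX0 := gap_ne_zero hW hp hu₁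
  have hmono := (strictMono_clock hX hX0 hb.ne').monotone
  have htmem : t ∈ Icc 0 (clock b (gap W p u₁) u₁) :=
    ⟨ht0, ht.le.trans (hmono (NNReal.coe_le_coe.2 hu'))⟩
  have hsI := invClock_mem_Icc hX hX0 hb.ne' u₁.coe_nonneg htmem
  have hrange := Icc_subset_Ioo_clock hX hX0 hb.ne' (u₁ := u₁) htmem
  refine ⟨⟨hsI.1, ?_⟩, hrange⟩
  by_contra hle
  push Not at hle
  have := hmono hle
  rw [clock_invClock_of_mem hX hX0 hb.ne' u₁.coe_nonneg (Ioo_subset_Icc_self hrange)] at this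
  exact absurd ht (not_lt.2 this)

/-- **The conjugated solution solves the image Loewner equation.** Let `g` solve the chordal
Loewner equation driven by `W` from `z ∈ ℍ` with lifetime `T`, and let `u' ≤ u₁`, `u' ≤ T`.
Then `Z_t = h_{υt}(g_{υt})` solves the chordal Loewner equation driven by the image driver `U`
from `N(z)` with lifetime `clock u'` (Lawler §6.3: "`dh̃_t(z)/dt = 2/(h̃_t(z) - Ũ*_t)`").
[cite: Lawler2005, §6.3] -/
theorem isSolution_imageSol {z : ℂ} (hz : 0 < z.im) {g : ℝ → ℂ} {T : WithTop ℝ≥0}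
    (hg : IsSolution W z g T) {u' : ℝ≥0} (hu' : u' ≤ u₁) (hu'T : (u' : WithTop ℝ≥0) ≤ T) :
    IsSolution (imageDriver W p u₁ a b) (moebN a b p z) (imageSol W p u₁ a b g)
      (clockNN W p u₁ b u') := by
  have hX := continuous_gap (u₁ := u₁) hW hp
  have hX0 := gap_ne_zero hW hp hu₁
  have hb0 := hb.ne'
  have h0 : (u₁ : ℝ) = u₁ := rfl
  -- times in the image time domain
  have hdom : ∀ {t : ℝ}, 0 ≤ t → ((t.toNNReal : ℝ≥0) : WithTop ℝ≥0) < clockNN W p u₁ b u' →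
      t < clock b (gap W p u₁) u' := fun {t} ht0 htT ↦ by
    have := WithTop.coe_lt_coe.1 htT
    rw [← NNReal.coe_lt_coe, Real.coe_toNNReal _ ht0, coe_clockNN hW hp hu₁ hb] at this
    exact this
  refine ⟨?_, fun t ht ↦ ?_, fun t ht0 htT ↦ ?_⟩
  · -- initial value
    rw [imageSol, invClock_zero hX hX0 hb0 u₁.coe_nonneg, hg.apply_zero, conjMap_zero_eq_moebN]
  · -- the equation
    obtain ⟨ht0, htT⟩ := ht
    have htT' := hdom ht0 htT
    obtain ⟨⟨hs0, hsu'⟩, hrange⟩ := invClock_mem_of_lt hW hp hu₁ hb hu' ht0 htT'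
    set s := invClock b (gap W p u₁) u₁ t with hs
    have hsT : ((s.toNNReal : ℝ≥0) : WithTop ℝ≥0) < T := by
      refine lt_of_lt_of_le (WithTop.coe_lt_coe.2 ?_) hu'T
      rw [← NNReal.coe_lt_coe, Real.coe_toNNReal _ hs0]
      exact hsu'
    -- a version of `g` differentiable at `s` (two-sided, also for `s = 0`)
    obtain ⟨g', hg'eq, hg'der⟩ := hg.exists_hasDerivAt_extension
    have hsmem : s ∈ Icc (0 : ℝ) u₁ := ⟨hs0, hsu'.le.trans (NNReal.coe_le_coe.2 hu')⟩
    have hWs : W s.toNNReal = poleFlow p (gap W p u₁) s - gap W p u₁ s :=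
      (poleFlow_gap_sub_gap hW hp hu₁ hsmem).symm
    have hgs : g' s = g s := hg'eq s hs0
    have hgsim : 0 < (g s).im := IsSolution.im_pos_holds hW hg hz s hs0 hsT
    have hY : HasDerivAt g' (2 / (g' s - ((poleFlow p (gap W p u₁) s - gap W p u₁ s : ℝ) : ℂ))) s := by
      have h1 := hg'der s hs0 hsT
      rwa [vectorField_apply, hWs] at h1
    have hYP : g' s ≠ poleFlow p (gap W p u₁) s := fun h ↦ by
      have := congrArg Complex.im h
      rw [hgs, ofReal_im] at this
      exact hgsim.ne' this
    have hYW : g' s ≠ ((poleFlow p (gap W p u₁) s - gap W p u₁ s : ℝ) : ℂ) := fun h ↦ by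
      have := congrArg Complex.im h
      rw [hgs, ofReal_im] at this
      exact hgsim.ne' this
    have hZ := hasDerivAt_conjMap_invClock (a := a) (p := p) hX hX0 hb0 u₁.coe_nonneg hrange hY
      hYP hYW
    -- replace `g'` by `g` along nonnegative levels and read the driver
    have hZ' : HasDerivWithinAt (imageSol W p u₁ a b g)
        (2 / (imageSol W p u₁ a b g t - imageDriver W p u₁ a b t.toNNReal))
        {t : ℝ | 0 ≤ t ∧ ((t.toNNReal : ℝ≥0) : WithTop ℝ≥0) < clockNN W p u₁ b u'} t := by
      have hev : ∀ r ∈ {t : ℝ | 0 ≤ t ∧ ((t.toNNReal : ℝ≥0) : WithTop ℝ≥0) < clockNN W p u₁ b u'},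
          imageSol W p u₁ a b g r = (fun r ↦ conjMap a b p (gap W p u₁) (invClock b (gap W p u₁) u₁ r)
            (g' (invClock b (gap W p u₁) u₁ r))) r := by
        intro r hr
        have hr0 : 0 ≤ invClock b (gap W p u₁) u₁ r :=
          (invClock_mem_of_lt hW hp hu₁ hb hu' hr.1 (hdom hr.1 hr.2)).1.1
        simp only [imageSol, hg'eq _ hr0]
      refine (hZ.hasDerivWithinAt.congr hev (hev t ⟨ht0, htT⟩)).congr_deriv ?_
      rw [← hs, hgs, imageDriver, timeChangedDriver_apply, Real.coe_toNNReal _ ht0, ← hs, imageSol]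
    rwa [vectorField_apply]
  · -- off the driving function: the solution lies in `ℍ`
    intro h
    have htT' := hdom ht0 htT
    obtain ⟨⟨hs0, hsu'⟩, -⟩ := invClock_mem_of_lt hW hp hu₁ hb hu' ht0 htT'
    have hsT : (((invClock b (gap W p u₁) u₁ t).toNNReal : ℝ≥0) : WithTop ℝ≥0) < T := by
      refine lt_of_lt_of_le (WithTop.coe_lt_coe.2 ?_) hu'T
      rw [← NNReal.coe_lt_coe, Real.coe_toNNReal _ hs0]
      exact hsu'
    have hgsim := IsSolution.im_pos_holds hW hg hz _ hs0 hsT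
    have him := im_conjMap_pos (W := W) (p := p) (u₁ := u₁) (a := a) hb
      (invClock b (gap W p u₁) u₁ t) hgsim
    rw [← imageSol, h, ofReal_im] at him
    exact lt_irrefl _ him

/-- **The image Loewner map evaluates the conjugated map.** For `u < u₁` and a point `z` of the
Loewner domain `H_u`, the point `N(z)` lies in the Loewner domain of the image driver at the
capacity time `clock u`, and `g^U_{clock u}(N z) = h_u(g_u(z))`. [cite: Lawler2005, §6.3] -/
theorem map_imageDriver_apply {u : ℝ≥0} (hu : u < u₁) {z : ℂ} (hz : z ∈ domain W u) :
    moebN a b p z ∈ domain (imageDriver W p u₁ a b) (clockNN W p u₁ b u) ∧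
      map (imageDriver W p u₁ a b) (clockNN W p u₁ b u) (moebN a b p z) =
        conjMap a b p (gap W p u₁) u (map W u z) := by
  have hX := continuous_gap (u₁ := u₁) hW hp
  have hX0 := gap_ne_zero hW hp hu₁
  rw [mem_domain_iff] at hz
  obtain ⟨hzH, hzT⟩ := hz
  have hz0 : z ≠ W 0 := ne_driving_of_lt_swallowingTime hzT
  obtain ⟨g, hg⟩ := exists_isSolution_swallowingTime_holds hW hz0
  -- an original time `u' ∈ (u, u₁]` still before the swallowing time of `z`
  obtain ⟨u', huu', hu'1, hu'T⟩ : ∃ u' : ℝ≥0, u < u' ∧ u' ≤ u₁ ∧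
      (u' : WithTop ℝ≥0) ≤ swallowingTime W z := by
    induction hT : swallowingTime W z with
    | top => exact ⟨u₁, hu, le_rfl, le_top⟩
    | coe t₀ =>
      rw [hT] at hzT
      have hut₀ : u < t₀ := WithTop.coe_lt_coe.1 hzT
      exact ⟨min u₁ t₀, lt_min hu hut₀, min_le_left _ _, WithTop.coe_le_coe.2 (min_le_right _ _)⟩
  have hsol := isSolution_imageSol (a := a) hW hp hu₁ hb hzH hg hu'1 hu'T
  have hlt : (clockNN W p u₁ b u : WithTop ℝ≥0) < clockNN W p u₁ b u' :=
    WithTop.coe_lt_coe.2 (clockNN_lt_clockNN hW hp hu₁ hb huu')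
  have hmap := map_eq_of_isSolution (continuous_imageDriver hW hp hu₁ hb) hsol hlt
  refine ⟨?_, ?_⟩
  · rw [mem_domain_iff]
    exact ⟨im_moebN_pos hb hzH, hlt.trans_le hsol.le_swallowingTime⟩
  · rw [hmap, imageSol, coe_clockNN hW hp hu₁ hb,
      invClock_clock hX hX0 hb.ne' u₁.coe_nonneg ⟨by linarith [u.coe_nonneg], by
        have : (u : ℝ) ≤ u₁ := NNReal.coe_le_coe.2 hu.le; linarith⟩,
      map_eq_of_isSolution hW hg hzT]

/-- **The image Loewner domain is the image of the Loewner domain**: for `u < u₁`,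
`H^U_{clock u} = N(H_u)`. The inclusion `⊇` is `map_imageDriver_apply`; for `⊆`, both Loewner
maps are bijections onto `ℍ` (`Loewner.bijOn_map`) intertwined by the automorphism `h_u` of `ℍ`
on the image of `H_u`, so no other point of the image domain can have the same image.
[cite: Lawler2005, §6.3] -/
theorem domain_imageDriver_eq {u : ℝ≥0} (hu : u < u₁) :
    domain (imageDriver W p u₁ a b) (clockNN W p u₁ b u) = moebN a b p '' domain W u := by
  have hUc := continuous_imageDriver (a := a) hW hp hu₁ hb
  refine Subset.antisymm (fun w hw ↦ ?_) ?_
  · -- `⊆`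
    set ω' := map (imageDriver W p u₁ a b) (clockNN W p u₁ b u) w with hω'
    have hω'H : 0 < ω'.im := mapsTo_map hUc _ hw
    have hyH : 0 < (conjMapInv W p u₁ a b u ω').im := im_conjMapInv_pos hb u hω'H
    obtain ⟨z, hzdom, hzeq⟩ := (bijOn_map hW u).surjOn hyH
    obtain ⟨hmem, hmap⟩ := map_imageDriver_apply hW hp hu₁ hb hu hzdom
    have hne : ω' ≠ farPoint a b (gap W p u₁) u := fun h ↦ by
      have := congrArg Complex.im h
      rw [ofReal_im] at this
      exact hω'H.ne' this
    rw [hzeq, conjMap_conjMapInv hb.ne' u hne] at hmap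
    have : moebN a b p z = w := (injOn_map hUc _) hmem hw (hmap.trans hω'.symm)
    exact ⟨z, hzdom, this⟩
  · -- `⊇`
    rintro _ ⟨z, hz, rfl⟩
    exact (map_imageDriver_apply hW hp hu₁ hb hu hz).1

omit hW hp hu₁ in
/-- `N` is injective on `ℍ` (indeed off the pole). [folklore] -/
theorem moebN_injOn : InjOn (moebN a b p) upperHalfPlaneSet := by
  intro z hz z' hz' h
  have hne : ∀ {y : ℂ}, 0 < y.im → (p : ℂ) - y ≠ 0 := fun {y} hy ↦ ofReal_sub_ne_zero p hy
  rw [moebN, moebN, add_right_inj] at h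
  have hb' : (b : ℂ) ≠ 0 := ofReal_ne_zero.2 hb.ne'
  have := div_eq_div_iff (hne hz) (hne hz') |>.1 h
  have h2 : (p : ℂ) - z' = (p : ℂ) - z := mul_left_cancel₀ hb' this
  exact (sub_right_inj.1 h2).symm

omit hW hp hu₁ in
/-- `N` maps `ℍ` onto `ℍ`: its inverse `w ↦ p - b/(w - a)` maps `ℍ` into `ℍ`. [folklore] -/
theorem moebN_surjOn : SurjOn (moebN a b p) upperHalfPlaneSet upperHalfPlaneSet := by
  intro w hw
  have hw' : 0 < w.im := hw
  have hne : w - (a : ℂ) ≠ 0 := sub_ofReal_ne_zero a hw'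
  refine ⟨(p : ℂ) - b / (w - a), ?_, ?_⟩
  · show 0 < ((p : ℂ) - b / (w - a)).im
    have hns : 0 < Complex.normSq (w - (a : ℂ)) := Complex.normSq_pos.2 hne
    have him : (w - (a : ℂ)).im = w.im := by simp
    rw [Complex.sub_im, ofReal_im, im_ofReal_div, him, zero_sub]
    have : -(-(b * w.im) / Complex.normSq (w - (a : ℂ))) = b * w.im / Complex.normSq (w - (a : ℂ)) := by
      ring
    rw [this]
    positivity
  · rw [moebN, sub_sub_cancel]
    have hb' : (b : ℂ) ≠ 0 := ofReal_ne_zero.2 hb.ne'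
    field_simp
    ring

/-- **The image hull is the image of the hull**: for `u < u₁`, `K^U_{clock u} = N(K_u)`
(complements in `ℍ` of the domains, `N` being a bijection of `ℍ`). Lawler §6.3: the image chain
is the chain of `Ũ*`. [cite: Lawler2005, §6.3 Thm. 6.13] -/
theorem hull_imageDriver_eq {u : ℝ≥0} (hu : u < u₁) :
    hull (imageDriver W p u₁ a b) (clockNN W p u₁ b u) = moebN a b p '' hull W u := by
  have hdom := domain_imageDriver_eq (a := a) hW hp hu₁ hb hu
  have hinj := moebN_injOn (a := a) (p := p) hb
  ext w
  constructor
  · intro hw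
    have hwH : w ∈ upperHalfPlaneSet := hull_subset _ _ hw
    obtain ⟨z, hzH, rfl⟩ := moebN_surjOn (a := a) (p := p) hb hwH
    refine ⟨z, ?_, rfl⟩
    by_contra hzK
    have hzdom : z ∈ domain W u := ⟨hzH, hzK⟩
    have : moebN a b p z ∈ domain (imageDriver W p u₁ a b) (clockNN W p u₁ b u) := by
      rw [hdom]; exact ⟨z, hzdom, rfl⟩
    exact this.2 hw
  · rintro ⟨z, hzK, rfl⟩
    have hzH : z ∈ upperHalfPlaneSet := hull_subset _ _ hzK
    refine by_contra fun hwK ↦ ?_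
    have hwdom : moebN a b p z ∈ domain (imageDriver W p u₁ a b) (clockNN W p u₁ b u) :=
      ⟨im_moebN_pos hb hzH, hwK⟩
    rw [hdom] at hwdom
    obtain ⟨z', hz'dom, heq⟩ := hwdom
    have : z' = z := hinj hz'dom.1 hzH heq
    subst this
    exact hz'dom.2 hzK

/-! ### The tracked real point `a = N(∞)` -/

/-- **The image far point solves the real image Loewner equation**: `t ↦ A_{υ t}` is a solution
driven by the image driver from the real point `a`, alive up to the level `clock (u₁ + 1)`
(`hasDerivAt_farPoint_invClock`; it stays off the driver, `A - W̃ = -b d₁/X ≠ 0`).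
[cite: Lawler2005, §6.3] -/
theorem isSolution_farPoint :
    IsSolution (imageDriver W p u₁ a b) (a : ℂ)
      (fun t ↦ ((farPoint a b (gap W p u₁) (invClock b (gap W p u₁) u₁ t) : ℝ) : ℂ))
      ((clock b (gap W p u₁) (u₁ + 1)).toNNReal : ℝ≥0) := by
  have hX := continuous_gap (u₁ := u₁) hW hp
  have hX0 := gap_ne_zero hW hp hu₁
  have hb0 := hb.ne'
  have hc1 : 0 ≤ clock b (gap W p u₁) (u₁ + 1) :=
    clock_nonneg hX hX0 hb0 (by linarith [u₁.coe_nonneg])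
  have hdom : ∀ {t : ℝ}, 0 ≤ t →
      ((t.toNNReal : ℝ≥0) : WithTop ℝ≥0) < ((clock b (gap W p u₁) (u₁ + 1)).toNNReal : ℝ≥0) →
      t ∈ Ioo (clock b (gap W p u₁) (-1)) (clock b (gap W p u₁) (u₁ + 1)) := fun {t} ht0 htT ↦ by
    have h1 := WithTop.coe_lt_coe.1 htT
    rw [← NNReal.coe_lt_coe, Real.coe_toNNReal _ ht0, Real.coe_toNNReal _ hc1] at h1
    have h2 : clock b (gap W p u₁) (-1) < 0 := by
      have := strictMono_clock hX hX0 hb0 (show (-1 : ℝ) < 0 by norm_num)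
      rwa [clock_zero] at this
    exact ⟨h2.trans_le ht0, h1⟩
  have hoff : ∀ s : ℝ, farPoint a b (gap W p u₁) s ≠ driver a b (gap W p u₁) s := fun s h ↦ by
    have h1 := farPoint_sub_driver (a := a) (b := b) (X := gap W p u₁) s
    rw [h, sub_self] at h1
    exact (neg_ne_zero.2 (div_ne_zero (mul_ne_zero hb0 (poleDeriv_pos s).ne') (hX0 s))) h1.symm
  refine ⟨?_, fun t ht ↦ ?_, fun t ht0 htT ↦ ?_⟩
  · dsimp only
    rw [invClock_zero hX hX0 hb0 u₁.coe_nonneg, farPoint_zero]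
  · obtain ⟨ht0, htT⟩ := ht
    have h := (hasDerivAt_farPoint_invClock (a := a) hX hX0 hb0 u₁.coe_nonneg (hdom ht0 htT)).ofReal_comp
    refine (h.hasDerivWithinAt.congr_deriv ?_)
    rw [vectorField_apply, imageDriver, timeChangedDriver_apply, Real.coe_toNNReal _ ht0]
    push_cast
    rfl
  · rw [imageDriver, timeChangedDriver_apply, Real.coe_toNNReal _ ht0]
    exact fun h ↦ hoff _ (ofReal_injective h)

/-- **The tracked real point is alive up to the horizon** and its image Loewner flow is the far
point: for `u ≤ u₁`, `clock u < T_a(U)` and `g^U_{clock u}(a) = A_u`. [cite: Lawler2005, §6.3] -/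
theorem map_imageDriver_far {u : ℝ≥0} (hu : u ≤ u₁) :
    (clockNN W p u₁ b u : WithTop ℝ≥0) < swallowingTime (imageDriver W p u₁ a b) a ∧
      map (imageDriver W p u₁ a b) (clockNN W p u₁ b u) a = farPoint a b (gap W p u₁) u := by
  have hX := continuous_gap (u₁ := u₁) hW hp
  have hX0 := gap_ne_zero hW hp hu₁
  have hb0 := hb.ne'
  have hsol := isSolution_farPoint (a := a) hW hp hu₁ hb
  have hlt : (clockNN W p u₁ b u : WithTop ℝ≥0) <
      ((clock b (gap W p u₁) (u₁ + 1)).toNNReal : ℝ≥0) := by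
    refine WithTop.coe_lt_coe.2 ?_
    rw [← NNReal.coe_lt_coe, coe_clockNN hW hp hu₁ hb, Real.coe_toNNReal _
      (clock_nonneg hX hX0 hb0 (by linarith [u₁.coe_nonneg]))]
    exact strictMono_clock hX hX0 hb0 (by
      have : (u : ℝ) ≤ u₁ := NNReal.coe_le_coe.2 hu; linarith)
  refine ⟨hlt.trans_le hsol.le_swallowingTime, ?_⟩
  rw [map_eq_of_isSolution (continuous_imageDriver hW hp hu₁ hb) hsol hlt]
  simp only [coe_clockNN hW hp hu₁ hb]
  rw [invClock_clock hX hX0 hb0 u₁.coe_nonneg ⟨by linarith [u.coe_nonneg], by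
    have : (u : ℝ) ≤ u₁ := NNReal.coe_le_coe.2 hu; linarith⟩]

/-- **The gap of the tracked real point under the image chain**: for `u ≤ u₁`,
`X̂_{clock u} := realFlowStop U a (clock u) = A_u - W̃_u = -b d₁(u)/X_u`. [cite: Lawler2005, §6.3] -/
theorem realFlowStop_imageDriver_far {u : ℝ≥0} (hu : u ≤ u₁) :
    realFlowStop (imageDriver W p u₁ a b) a (clockNN W p u₁ b u) =
      -(b * poleDeriv (gap W p u₁) u / gap W p u₁ u) := by
  obtain ⟨hlt, hmap⟩ := map_imageDriver_far (a := a) hW hp hu₁ hb hu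
  rw [realFlowStop_of_lt hlt, realFlow_apply, hmap, ofReal_re, imageDriver_clockNN hW hp hu₁ hb hu,
    farPoint_sub_driver]

end Chordal

end MoebiusPole

end Literature.Probability.RandomPlanarGeometry

end
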